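import Mathlib
import HarnessLib
import Summits.NavierStokesRegularity.NavierStokesRegularity.Theorems.HalfSpaceWindowDoorCirculationCarryingRigidityDefs
import Summits.NavierStokesRegularity.NavierStokesRegularity.Theorems.HalfSpaceWindowDoorCirculationCarryingRigidityReduction
import Summits.NavierStokesRegularity.NavierStokesRegularity.Theorems.HalfSpaceWindowDoorCirculationCarryingRigidityCriticalStretchingAnalytic
import Summits.NavierStokesRegularity.NavierStokesRegularity.Theorems.HalfSpaceWindowDoorCirculationCarryingRigidityWindowedFlux
import Literature.Analysis.UnboundedOperators.HeatKernelBoundedData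
import Literature.Analysis.FluidPDE.AxisymNoSwirlVorticity
import Summits.NavierStokesRegularity.NavierStokesRegularity.Theorems.HalfSpaceWindowDoorCirculationCarryingRigidityPlaneFluxDynamics
import Summits.NavierStokesRegularity.NavierStokesRegularity.Theorems.HalfSpaceWindowDoorCirculationCarryingRigidityTiltingIdentity
import Summits.NavierStokesRegularity.NavierStokesRegularity.Theorems.HalfSpaceWindowDoorCirculationCarryingRigidityTiltingFlux
import Literature.Analysis.UnboundedOperators.HeatKernelHeatEquation
import Literature.Analysis.UnboundedOperators.HeatFlowCalculus
import Literature.Analysis.UnboundedOperators.HeatExtensionHarnack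
import Literature.Analysis.UnboundedOperators.HeatKernelGradient
import Literature.Analysis.UnboundedOperators.HeatKernelReversePoincare
import Literature.Analysis.FluidPDE.AxisymNoSwirlImpulseSlice
import Literature.Analysis.FluidPDE.AxisymHouLiVariables
import Literature.Analysis.Calculus.IicRpowTails
import Literature.Analysis.FluidPDE.ConstantinFeffermanStretching
import Summits.NavierStokesRegularity.NavierStokesRegularity.Theorems.PoloidalWindowDoorPoloidalWindowRigidityScrewKinematics
import Summits.NavierStokesRegularity.NavierStokesRegularity.Theorems.HalfSpaceWindowDoorCirculationCarryingRigidityGaussKernel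
import Summits.NavierStokesRegularity.NavierStokesRegularity.Theorems.HalfSpaceWindowDoorCirculationCarryingRigidityGaussCirculation
import Summits.NavierStokesRegularity.NavierStokesRegularity.Theorems.HalfSpaceWindowDoorCirculationCarryingRigidityGaussStein

/-!
# Route `HalfSpaceWindowDoor`, crux `CirculationCarryingRigidity` (stmt-NavierStokesRegularity-25311) — line «gauss-swirl»,
# part `GaussTilting`: backward Gaussian time-calculus (`hasDerivAt_G_backward`), Green against the Gaussian (`integral_timeWeight_G_mul_eq`),
the transport–tilting pairing `∫G[(v·∇)ω − (ω·∇)v]₃ = −(∫∂₀G F₀ + ∫∂₁G F₁)` (`integral_G_mul_convect_sub_stretch`), the second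
Gaussian moment `integral_norm_sq_mul_heatKernel_E3` (`∫‖y‖²G_t = 6t` on `ℝ³`) and the sign-free INFLOW BOUND `abs_gaussInflow_le`
(`|ℐ(t;x₀)[v(s)]| ≤ (4π)^{3/2}·12C²·t/(−s)` for every door-class profile)

LINE «gauss-swirl» = ideator ns-idea-4 g11 (D-0145, files-only; critic of record idea-crit-3: PASS, grade new-combination on the wall W6
`…Defs.HemisphereLiouvilleE3`), file of record `pub/ideators/ns-idea-4/lines/gauss-swirl/GaussSwirl_v1_4.lean` (sha16 9f36760ac8cb3b0a,
`lean check` rc 0, sorries 1 = the research statement K1 only), card `LINE-gauss-swirl_v1_4.md`, PORT-MAP.md 5a0f471fb69fa47f.  PORTED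
INTO THE TREE by the LEAD of 25311 (ns-hsw-p1 g6, cell pub-ns-dss) as census support `--supports stmt-NavierStokesRegularity-25311
--as helper`: the proof texts below are the ideator's, VERBATIM modulo the split into ≤ 400-line modules, the `E3 ↦ EuclideanSpace ℝ
(Fin 3)` spelling, the namespace, added one-line docstrings and two `_`-renamings for the unused-variable linter; the vocabulary
(`InDoorClass`, `SignE3`, `gauss`, `angMom`, `gaussAngMom` = 𝒢, `gaussInflow` = ℐ, and the obligation / stratum Props) lives in
`…CirculationCarryingRigidityDefs`.

THE LINE IN ONE PARAGRAPH.  2D one-signed vorticity has the exact law `d/dt∫|x|²ω = 4νΦ`, which alone kills ancient flows with `Φ > 0`;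
in the 3D closed hemisphere (`ω₃ ≥ 0`) it survives for the GAUSSIAN AXIAL ANGULAR MOMENTUM `𝒢(t;x₀) = t^{-3/2}∫e^{−|x−x₀|²/4t} g`
(`= 2t^{-1/2}∫e^{…}ω₃ ≥ 0`), because against the divergence-free Gaussian swirl field `K_t(x−x₀)·e₃×(x−x₀)` pressure AND vortex tilting
drop out exactly, leaving ONE signed residue, the inflow correlation `ℐ = t^{-3/2}∫e^{…}((x−x₀)·v) g`: `d𝒢/ds = −𝒢/(s₀−s) − ℐ/(2(s₀−s))`;
with the time-only Type-I rate `𝒢/(s₀−s) → 0` in the far past, so «no inflow about ONE space–time axis before some epoch ⇒ poloidal».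

WHAT THIS IS NOT: not a statement about Navier–Stokes regularity (Clay A).  The door statements are regularity CRITERIA about
HYPOTHETICAL blow-up profiles (KNSS ancient mild solutions); the research statement K1 `PersistentAxis` (⟺ the wall) is NOT proved,
NOT registered and nothing is closed by this file; item 25311 stays OPEN at its research stub.
-/

noncomputable section

-- the summit and its single sub-problem share the name (CONVENTIONS §1), as in every Theorems file
set_option linter.dupNamespace false

namespace Summit.NavierStokesRegularity.NavierStokesRegularity.Theorems.HalfSpaceWindowDoorCirculationCarryingRigidityGaussTilting


open scoped BigOperators Topology MeasureTheory InnerProductSpace RealInnerProductSpace Laplacian ContDiff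
open Filter Set Function MeasureTheory Metric
open Literature.Analysis Literature.Analysis.FluidPDE Literature.Analysis.UnboundedOperators
open Summit.NavierStokesRegularity.NavierStokesRegularity.Theses.HalfSpaceWindowDoor
open Summit.NavierStokesRegularity.NavierStokesRegularity.Theorems.HalfSpaceWindowDoorCirculationCarryingRigidityDefs
open Summit.NavierStokesRegularity.NavierStokesRegularity.Theorems.HalfSpaceWindowDoorCirculationCarryingRigidityReduction
  (circulationCarryingRigidity_of_hemisphereLiouvilleE3)
open Summit.NavierStokesRegularity.NavierStokesRegularity.Theorems.HalfSpaceWindowDoorCirculationCarryingRigidityCriticalStretchingAnalytic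
  (inner_curl_e3_eq_zero_of_far_past)
open Summit.NavierStokesRegularity.NavierStokesRegularity.Theorems.LocalSineTubeDoorProfileAlignedWindowRigidityAncient
  (bdd_of_hasTypeITimeDecay analyticOnNhd_slice)
open Summit.NavierStokesRegularity.NavierStokesRegularity.Theorems.PoloidalWindowDoorPoloidalWindowRigidityClassSpaceTimeRates
  (exists_fderiv_rate_of_class' exists_iteratedFDeriv_two_rate_of_class' exists_iteratedFDeriv_three_rate_of_class)
open Summit.NavierStokesRegularity.NavierStokesRegularity.Theorems.HalfSpaceWindowDoorCirculationCarryingRigidityPlaneFluxDynamics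
  (hasDerivAt_inner_curl_e3_convect)
open Summit.NavierStokesRegularity.NavierStokesRegularity.Theorems.HalfSpaceWindowDoorCirculationCarryingRigidityTiltingIdentity
  (convect_sub_stretch_two_eq_divh)
open Summit.NavierStokesRegularity.NavierStokesRegularity.Theorems.HalfSpaceWindowDoorCirculationCarryingRigidityTiltingFlux
  (contDiff_flux norm_flux_le norm_fderiv_flux_le)
open Summit.NavierStokesRegularity.NavierStokesRegularity.Theorems.HalfSpaceWindowDoorCirculationCarryingRigiditySubcriticalStretching
  (hasDerivAt_inner_curl_e3 fderiv_inner_e3_apply laplacian_inner_e3)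
open Summit.NavierStokesRegularity.NavierStokesRegularity.Theorems.HalfSpaceWindowDoorCirculationCarryingRigidityPlaneFluxHeightWindow
  (abs_inner_e3_le contDiff_one_curl)
open Summit.NavierStokesRegularity.NavierStokesRegularity.Theorems.HalfSpaceWindowDoorCirculationCarryingRigidityPlaneLaplacian
  (contDiff_two_curl norm_iteratedFDeriv_two_inner_e3_le)
open Summit.NavierStokesRegularity.NavierStokesRegularity.Theorems.ChiralWindowDoorClassDerivDecay (exists_classical_of_class)
open Summit.NavierStokesRegularity.NavierStokesRegularity.Theorems.PoloidalWindowDoorPoloidalWindowRigidityScrewKinematics (inner_eq_three)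
open Summit.NavierStokesRegularity.NavierStokesRegularity.Theorems.HalfSpaceWindowDoorCirculationCarryingRigidityGaussKernel
open Summit.NavierStokesRegularity.NavierStokesRegularity.Theorems.HalfSpaceWindowDoorCirculationCarryingRigidityGaussCirculation
open Summit.NavierStokesRegularity.NavierStokesRegularity.Theorems.HalfSpaceWindowDoorCirculationCarryingRigidityGaussStein

/-! ### §2d (v1.2) Backward Gaussian time-calculus, Green against the Gaussian, the transport–tilting pairing, and the DYNAMIC
Gaussian vorticity law on the door class `d/ds ∫ G_{s₀−s} ω₃ = ∫ ∂₀G F₀ + ∫ ∂₁G F₁` (O1a, PROVED; answers critic note N2 —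
time-differentiability inside the Bochner integral by `hasDerivAt_integral_of_dominated_loc_of_deriv_le` with the Gaussian
`e^{−‖y‖²/16(s₀−s)}` as dominating function, LEAD `hasDerivAt_windowedFlux_time(_of_class)` pattern) -/

section KernelTime
variable {t : ℝ} (x₀ : (EuclideanSpace ℝ (Fin 3)))

/-- Backward time-derivative of the Gaussian along `t = s₀ − σ`: `∂_σ G_{s₀−σ}(z) = −(‖z‖²/4t² − 3/2t)·G`. -/
theorem hasDerivAt_G_backward {s₀ σ : ℝ} (hσ : σ < s₀) (z : (EuclideanSpace ℝ (Fin 3))) :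
    HasDerivAt (fun σ' => heatKernel (s₀ - σ') z)
      (-((‖z‖ ^ 2 / (4 * (s₀ - σ) ^ 2) - (3 : ℝ) / (2 * (s₀ - σ))) * heatKernel (s₀ - σ) z)) σ := by
  have ht : 0 < s₀ - σ := by linarith
  have hK := hasDerivAt_heatKernel_time (E := (EuclideanSpace ℝ (Fin 3))) ht z
  rw [finrank_euclideanSpace_fin] at hK
  have hsub : HasDerivAt (fun σ' : ℝ => s₀ - σ') (-1) σ := by
    simpa using (hasDerivAt_id σ).const_sub s₀
  have h : HasDerivAt (fun σ' => heatKernel (s₀ - σ') z)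
      (((‖z‖ ^ 2 / (4 * (s₀ - σ) ^ 2) - (3 : ℝ) / (2 * (s₀ - σ))) * heatKernel (s₀ - σ) z) * (-1)) σ := by
    exact hK.comp σ hsub
  refine h.congr_deriv ?_
  ring

end KernelTime

/-! ### Green's identity against the Gaussian: `∫ (ΔG_t)(x − x₀) f = ∫ G_t(x − x₀) Δf` -/

/-- Green against the Gaussian: `∫(−∂_σG)f + ∫GΔf = 0` for bounded `C²` data with bounded derivatives. -/
theorem integral_timeWeight_G_mul_eq {f : (EuclideanSpace ℝ (Fin 3)) → ℝ} (hf : ContDiff ℝ 2 f) {C₀ C₁ C₂ : ℝ}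
    (h0 : ∀ z, ‖f z‖ ≤ C₀) (h1 : ∀ z, ‖fderiv ℝ f z‖ ≤ C₁) (h2 : ∀ z, ‖fderiv ℝ (fderiv ℝ f) z‖ ≤ C₂)
    {t : ℝ} (ht : 0 < t) (x₀ : (EuclideanSpace ℝ (Fin 3))) :
    ∫ x, ((‖x - x₀‖ ^ 2 / (4 * t ^ 2) - (3 : ℝ) / (2 * t)) * heatKernel t (x - x₀)) * f x =
      ∫ x, heatKernel t (x - x₀) * (Δ f) x := by
  have hA := laplacian_heatExtension_of_bounded (F := ℝ) hf h0 h1 h2 ht x₀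
  have hmem : MemLp f ⊤ volume := memLp_top_of_bound hf.continuous.aestronglyMeasurable C₀ (ae_of_all _ h0)
  have hB := laplacian_heatExtension_eq_integral (F := ℝ) ht hmem le_top x₀
  rw [hB, heatExtension_eq_integral_mul] at hA
  rw [finrank_euclideanSpace_fin] at hA
  have hl : (fun x => ((‖x - x₀‖ ^ 2 / (4 * t ^ 2) - (3 : ℝ) / (2 * t)) * heatKernel t (x - x₀)) * f x) =
      fun y => ((‖x₀ - y‖ ^ 2 / (4 * t ^ 2) - ((3 : ℕ) : ℝ) / (2 * t)) * heatKernel t (x₀ - y)) • f y := by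
    funext y
    rw [smul_eq_mul, norm_sub_rev, ← heatKernel_neg t (x₀ - y), neg_sub]
    push_cast; ring
  have hr : (fun x => heatKernel t (x - x₀) * (Δ f) x) = fun z => heatKernel t (x₀ - z) * (Δ f) z := by
    funext z; rw [← heatKernel_neg t (x₀ - z), neg_sub]
  rw [hl, hr]
  exact hA

/-! ### The transport–tilting pairing against the Gaussian: with `Fⱼ = uⱼw₂ − wⱼu₂` and the tree identity
`((u·∇)w)₂ − ((w·∇)u)₂ = ∂₀F₀ + ∂₁F₁` (`convect_sub_stretch_two_eq_divh`), one whole-space integration by parts gives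
`∫ G (∂₀F₀ + ∂₁F₁) = −(∫ ∂₀G F₀ + ∫ ∂₁G F₁)`. -/

section Tilting
variable {u w : (EuclideanSpace ℝ (Fin 3)) → (EuclideanSpace ℝ (Fin 3))}

/-- One whole-space integration by parts of a bounded `C¹` scalar with bounded gradient against the Gaussian:
`∫ G ∂ⱼφ = −∫ ∂ⱼG φ`. -/
theorem integral_G_mul_fderiv_eq {φ : (EuclideanSpace ℝ (Fin 3)) → ℝ} (hφ : ContDiff ℝ 1 φ) {B M : ℝ} (hB : ∀ x, ‖φ x‖ ≤ B)
    (hM : ∀ x, ‖fderiv ℝ φ x‖ ≤ M) {t : ℝ} (ht : 0 < t) (x₀ : (EuclideanSpace ℝ (Fin 3))) (j : Fin 3) :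
    Integrable (fun x => heatKernel t (x - x₀) * fderiv ℝ φ x (EuclideanSpace.single j 1)) ∧
    ∫ x, heatKernel t (x - x₀) * fderiv ℝ φ x (EuclideanSpace.single j 1) =
      -∫ x, fderiv ℝ (fun y : (EuclideanSpace ℝ (Fin 3)) => heatKernel t (y - x₀)) x (EuclideanSpace.single j 1) * φ x := by
  have hφc : Continuous φ := hφ.continuous
  have hφd : Differentiable ℝ φ := hφ.differentiable one_ne_zero
  have hDφc : Continuous (fun x => fderiv ℝ φ x (EuclideanSpace.single j 1)) :=
    (hφ.continuous_fderiv one_ne_zero).clm_apply continuous_const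
  have hDφb : ∀ x, ‖fderiv ℝ φ x (EuclideanSpace.single j 1)‖ ≤ M := fun x => by
    refine (ContinuousLinearMap.le_opNorm _ _).trans ?_
    have hn : ‖(EuclideanSpace.single j (1 : ℝ) : (EuclideanSpace ℝ (Fin 3)))‖ = 1 := by simp
    rw [hn, mul_one]; exact hM x
  have I1 : Integrable (fun x => fderiv ℝ (fun y : (EuclideanSpace ℝ (Fin 3)) => heatKernel t (y - x₀)) x (EuclideanSpace.single j 1) * φ x) :=
    (integrable_fderiv_G_apply x₀ ht j).mul_bdd hφc.aestronglyMeasurable (ae_of_all _ hB)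
  have I2 : Integrable (fun x => heatKernel t (x - x₀) * fderiv ℝ φ x (EuclideanSpace.single j 1)) :=
    (integrable_G x₀ ht).mul_bdd hDφc.aestronglyMeasurable (ae_of_all _ hDφb)
  have I3 : Integrable (fun x => heatKernel t (x - x₀) * φ x) :=
    (integrable_G x₀ ht).mul_bdd hφc.aestronglyMeasurable (ae_of_all _ hB)
  refine ⟨I2, ?_⟩
  have IBP := integral_mul_fderiv_eq_neg_fderiv_mul_of_integrable (μ := volume) I1 I2 I3
    (fun y _ => (hasFDerivAt_G x₀ t y).differentiableAt) (fun y _ => hφd y)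
  exact IBP

/-- **The Gaussian transport–tilting pairing.**  For bounded `C¹` divergence-free fields `u, w` with bounded gradients,
`∫ G_t(x − x₀) [((u·∇)w)₂ − ((w·∇)u)₂](x) dx = −(∫ ∂₀G F₀ + ∫ ∂₁G F₁)`, `Fⱼ = uⱼw₂ − wⱼu₂`. -/
theorem integral_G_mul_convect_sub_stretch (hu : ContDiff ℝ 1 u) (hw : ContDiff ℝ 1 w) {Bu Bw Mu Mw : ℝ}
    (hBu : ∀ x, ‖u x‖ ≤ Bu) (hBw : ∀ x, ‖w x‖ ≤ Bw) (hMu : ∀ x, ‖fderiv ℝ u x‖ ≤ Mu)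
    (hMw : ∀ x, ‖fderiv ℝ w x‖ ≤ Mw) (hdivu : VectorCalculus.IsDivFree u) (hdivw : VectorCalculus.IsDivFree w)
    {t : ℝ} (ht : 0 < t) (x₀ : (EuclideanSpace ℝ (Fin 3))) :
    Integrable (fun x => heatKernel t (x - x₀) * (convect u w x 2 - convect w u x 2)) ∧
    ∫ x, heatKernel t (x - x₀) * (convect u w x 2 - convect w u x 2) =
      -((∫ x, fderiv ℝ (fun y : (EuclideanSpace ℝ (Fin 3)) => heatKernel t (y - x₀)) x (EuclideanSpace.single 0 1) *
            (u x 0 * w x 2 - w x 0 * u x 2)) +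
        ∫ x, fderiv ℝ (fun y : (EuclideanSpace ℝ (Fin 3)) => heatKernel t (y - x₀)) x (EuclideanSpace.single 1 1) *
            (u x 1 * w x 2 - w x 1 * u x 2)) := by
  have hud : Differentiable ℝ u := hu.differentiable one_ne_zero
  have hwd : Differentiable ℝ w := hw.differentiable one_ne_zero
  obtain ⟨I0, E0⟩ := integral_G_mul_fderiv_eq (contDiff_flux hu hw 0) (norm_flux_le hBu hBw 0)
    (norm_fderiv_flux_le hu hw hBu hBw hMu hMw 0) ht x₀ 0
  obtain ⟨I1, E1⟩ := integral_G_mul_fderiv_eq (contDiff_flux hu hw 1) (norm_flux_le hBu hBw 1)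
    (norm_fderiv_flux_le hu hw hBu hBw hMu hMw 1) ht x₀ 1
  have hpt : ∀ x, heatKernel t (x - x₀) * (convect u w x 2 - convect w u x 2) =
      heatKernel t (x - x₀) * fderiv ℝ (fun y => u y 0 * w y 2 - w y 0 * u y 2) x (EuclideanSpace.single 0 1) +
        heatKernel t (x - x₀) * fderiv ℝ (fun y => u y 1 * w y 2 - w y 1 * u y 2) x (EuclideanSpace.single 1 1) := by
    intro x
    rw [convect_sub_stretch_two_eq_divh (hud x) (hwd x) (hdivu x) (hdivw x), mul_add]
  have hfun : (fun x => heatKernel t (x - x₀) * (convect u w x 2 - convect w u x 2)) =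
      fun x => heatKernel t (x - x₀) * fderiv ℝ (fun y => u y 0 * w y 2 - w y 0 * u y 2) x (EuclideanSpace.single 0 1) +
        heatKernel t (x - x₀) * fderiv ℝ (fun y => u y 1 * w y 2 - w y 1 * u y 2) x (EuclideanSpace.single 1 1) :=
    funext hpt
  refine ⟨?_, ?_⟩
  · rw [hfun]; exact I0.add I1
  · rw [hfun, integral_add I0 I1, E0, E1]; ring

end Tilting

/-- Second Gaussian moment on `ℝ³`: `∫ ‖y‖² G_t(y) dy = 6t`. -/
theorem integral_norm_sq_mul_heatKernel_E3 {t : ℝ} (ht : 0 < t) :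
    ∫ y : (EuclideanSpace ℝ (Fin 3)), ‖y‖ ^ 2 * heatKernel t y = 6 * t := by
  set e : Fin 3 → (EuclideanSpace ℝ (Fin 3)) := fun i => EuclideanSpace.single i (1 : ℝ) with he
  have hpt : ∀ y : (EuclideanSpace ℝ (Fin 3)), ‖y‖ ^ 2 * heatKernel t y = ∑ i, ⟪y, e i⟫_ℝ * ⟪y, e i⟫_ℝ * heatKernel t y := by
    intro y
    rw [EuclideanSpace.real_norm_sq_eq, Finset.sum_mul]
    refine Finset.sum_congr rfl fun i _ => ?_
    rw [he, EuclideanSpace.inner_single_right, RCLike.conj_to_real, one_mul, sq]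
  have hint : ∀ i, Integrable (fun y : (EuclideanSpace ℝ (Fin 3)) => ⟪y, e i⟫_ℝ * ⟪y, e i⟫_ℝ * heatKernel t y) := by
    intro i
    refine (integrable_norm_sq_mul_heatKernel (E := (EuclideanSpace ℝ (Fin 3))) ht).mono' ?_ (Eventually.of_forall fun y => ?_)
    · exact (((continuous_id.inner continuous_const).mul (continuous_id.inner continuous_const)).mul
        (continuous_heatKernel t)).aestronglyMeasurable
    · have hG : 0 ≤ heatKernel t y := (heatKernel_pos ht y).le
      have h1 : |⟪y, e i⟫_ℝ| ≤ ‖y‖ := by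
        rw [he, EuclideanSpace.inner_single_right, RCLike.conj_to_real, one_mul, ← Real.norm_eq_abs]
        exact PiLp.norm_apply_le y i
      rw [Real.norm_eq_abs, abs_mul, abs_mul, abs_of_nonneg hG]
      have h2 : |⟪y, e i⟫_ℝ| * |⟪y, e i⟫_ℝ| ≤ ‖y‖ * ‖y‖ :=
        mul_le_mul h1 h1 (abs_nonneg _) (norm_nonneg _)
      calc |⟪y, e i⟫_ℝ| * |⟪y, e i⟫_ℝ| * heatKernel t y ≤ ‖y‖ * ‖y‖ * heatKernel t y :=
            mul_le_mul_of_nonneg_right h2 hG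
        _ = ‖y‖ ^ 2 * heatKernel t y := by ring
  simp_rw [hpt]
  rw [integral_finsetSum _ fun i _ => hint i]
  have hval : ∀ i, ∫ y : (EuclideanSpace ℝ (Fin 3)), ⟪y, e i⟫_ℝ * ⟪y, e i⟫_ℝ * heatKernel t y = 2 * t := by
    intro i
    rw [integral_inner_mul_inner_mul_heatKernel ht (e i) (e i), he, EuclideanSpace.inner_single_right, RCLike.conj_to_real, one_mul]
    simp
  simp_rw [hval]
  simp
  ring

/-- **Inflow bound (sign-free).**  `|ℐ(t; x₀)[v(s)]| ≤ (4π)^{3/2}·12C²·t/(−s)` for a door-class profile (`‖v‖ ≤ C/√(−s)`,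
`|⟪y, v⟫ g| ≤ 2‖y‖²‖v‖²`, second Gaussian moment `6t·(4πt)^{3/2}`). -/
theorem abs_gaussInflow_le {C : ℝ} {v : ℝ → (EuclideanSpace ℝ (Fin 3)) → (EuclideanSpace ℝ (Fin 3))} (hv : InDoorClass C v) (x₀ : (EuclideanSpace ℝ (Fin 3))) {t s : ℝ}
    (ht : 0 < t) (hs : s < 0) :
    |gaussInflow t x₀ (v s)| ≤ (4 * Real.pi) ^ ((3 : ℝ) / 2) * (12 * C ^ 2) * (t / (-s)) := by
  obtain ⟨hrate, -, -, -⟩ := hv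
  have hs0 : 0 < -s := by linarith
  set K : ℝ := (4 * Real.pi * t) ^ ((3 : ℝ) / 2) * (2 * (C ^ 2 / (-s))) with hK_def
  have hK0 : 0 ≤ K := by positivity
  have hpt : ∀ x, ‖gauss t x₀ x * (⟪x - x₀, v s x⟫_ℝ * angMom x₀ (v s) x)‖
      ≤ K * (‖x - x₀‖ ^ 2 * heatKernel t (x - x₀)) := by
    intro x
    have hG : 0 ≤ heatKernel t (x - x₀) := (heatKernel_pos ht _).le
    have hv' : ‖v s x‖ ≤ C / Real.sqrt (-s) := hrate s hs x
    have hC0 : 0 ≤ C / Real.sqrt (-s) := (norm_nonneg _).trans hv'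
    have hv2 : ‖v s x‖ ^ 2 ≤ C ^ 2 / (-s) := by
      calc ‖v s x‖ ^ 2 ≤ (C / Real.sqrt (-s)) ^ 2 := pow_le_pow_left₀ (norm_nonneg _) hv' 2
        _ = C ^ 2 / (-s) := by rw [div_pow, Real.sq_sqrt hs0.le]
    have h1 : |⟪x - x₀, v s x⟫_ℝ| ≤ ‖x - x₀‖ * ‖v s x‖ := abs_real_inner_le_norm _ _
    have h2 : |angMom x₀ (v s) x| ≤ 2 * ‖x - x₀‖ * ‖v s x‖ := abs_angMom_le x₀ (v s) x
    have h12 : |⟪x - x₀, v s x⟫_ℝ * angMom x₀ (v s) x| ≤ 2 * ‖x - x₀‖ ^ 2 * (C ^ 2 / (-s)) := by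
      rw [abs_mul]
      calc |⟪x - x₀, v s x⟫_ℝ| * |angMom x₀ (v s) x|
          ≤ (‖x - x₀‖ * ‖v s x‖) * (2 * ‖x - x₀‖ * ‖v s x‖) :=
            mul_le_mul h1 h2 (abs_nonneg _) (by positivity)
        _ = 2 * ‖x - x₀‖ ^ 2 * ‖v s x‖ ^ 2 := by ring
        _ ≤ 2 * ‖x - x₀‖ ^ 2 * (C ^ 2 / (-s)) := by gcongr
    rw [Real.norm_eq_abs, abs_mul, gauss_eq_heatKernel ht, abs_of_nonneg (mul_nonneg (by positivity) hG)]
    calc (4 * Real.pi * t) ^ ((3 : ℝ) / 2) * heatKernel t (x - x₀) * |⟪x - x₀, v s x⟫_ℝ * angMom x₀ (v s) x|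
        ≤ (4 * Real.pi * t) ^ ((3 : ℝ) / 2) * heatKernel t (x - x₀) * (2 * ‖x - x₀‖ ^ 2 * (C ^ 2 / (-s))) :=
          mul_le_mul_of_nonneg_left h12 (mul_nonneg (by positivity) hG)
      _ = K * (‖x - x₀‖ ^ 2 * heatKernel t (x - x₀)) := by rw [hK_def]; ring
  have hint : Integrable (fun x : (EuclideanSpace ℝ (Fin 3)) => K * (‖x - x₀‖ ^ 2 * heatKernel t (x - x₀))) :=
    ((integrable_norm_sq_mul_heatKernel (E := (EuclideanSpace ℝ (Fin 3))) ht).comp_sub_right x₀).const_mul K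
  have hI : ‖∫ x, gauss t x₀ x * (⟪x - x₀, v s x⟫_ℝ * angMom x₀ (v s) x)‖
      ≤ ∫ x : (EuclideanSpace ℝ (Fin 3)), K * (‖x - x₀‖ ^ 2 * heatKernel t (x - x₀)) :=
    norm_integral_le_of_norm_le hint (Eventually.of_forall hpt)
  have hmom : ∫ x : (EuclideanSpace ℝ (Fin 3)), K * (‖x - x₀‖ ^ 2 * heatKernel t (x - x₀)) = K * (6 * t) := by
    rw [integral_const_mul]
    congr 1
    rw [integral_sub_right_eq_self (fun y : (EuclideanSpace ℝ (Fin 3)) => ‖y‖ ^ 2 * heatKernel t y) x₀]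
    exact integral_norm_sq_mul_heatKernel_E3 ht
  unfold gaussInflow
  rw [abs_mul, abs_of_nonneg (Real.rpow_nonneg ht.le _)]
  rw [Real.norm_eq_abs] at hI
  calc t ^ (-(3 : ℝ) / 2) * |∫ x, gauss t x₀ x * (⟪x - x₀, v s x⟫_ℝ * angMom x₀ (v s) x)|
      ≤ t ^ (-(3 : ℝ) / 2) * (K * (6 * t)) :=
        mul_le_mul_of_nonneg_left (hI.trans_eq hmom) (Real.rpow_nonneg ht.le _)
    _ = (t ^ (-(3 : ℝ) / 2) * (4 * Real.pi * t) ^ ((3 : ℝ) / 2)) * (12 * C ^ 2) * (t / (-s)) := by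
        rw [hK_def]; ring
    _ = (4 * Real.pi) ^ ((3 : ℝ) / 2) * (12 * C ^ 2) * (t / (-s)) := by rw [rpow_scale ht]

end Summit.NavierStokesRegularity.NavierStokesRegularity.Theorems.HalfSpaceWindowDoorCirculationCarryingRigidityGaussTilting

end
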